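import Literature.MathematicalPhysics.QuantumFieldTheory.Balaban1983to89.T4RenewalChains

/-!
# `Balaban1983to89.T4RecordChains` — the NE7b records carrier `T4PersistentHistoryCount.slotDom_of_records` (member P1)
INHABITED END TO END, NON-VACUOUSLY, on the multiplicative renewal-chain run of `T4RenewalChains` (member P2):
every pending chain is a record, every clause of the wall binder `hdom` discharged, both NE7b members on ONE toy
(cell `pub-balaban`, T4-DAG v20 §6 NE7b / §5 row T4-U5c.E, node U5c; kernel siblings `T4PersistentHistoryCount`,
`T4PersistenceDictionary` (this lineage: the records carrier), `T4RenewalChains` (t4-ne7b-p2: the run model and the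
`EventDom` chain), `T4HistoryPeeling` / `T4WeightBudget` (pv14: `SlotDom`, `RelWeightBound`); record
`t4/T4-EST-NE7b-P1.md` v1.5 §0 (k))

HONEST FRAMING (cell `pub-balaban`, T4-DAG PAGE 1).  The cell's T4 target is rung (B)+1: existence AND uniqueness of the
`N → ∞` limit of gauge-invariant expectations at FIXED PHYSICAL COUPLING g_phys ON THE FINITE FOUR-TORUS, conditional on
`BetaPertH` (B), eventually (B^μ).  NOT infinite volume, NOT a mass gap, NOT the Clay problem, NOT summit progress.
This file is a TOY-MODEL CERTIFICATE about the SHAPE of one cell-internal carrier; it asserts NOTHING about Bałaban's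
expansion and narrows no wall.

THE QUESTION (cell-internal).  The counting member P1 of NE7b delivers `T4PersistentHistoryCount.slotDom_of_records`:
from explicit slots, explicit RECORDS `records W j K (E K j) b` (subsets of an event universe satisfying the SPAN
condition `SpanLE`), residual budgets `ρ̄`, `η̄`, the rate `Λ·e^{η̄ − κ₁} < 1` and ONE existential binder `hdom` — per
`(K, t)` a switch-off structure, a slot labelling, PER-RECORD PRICES `0 ≤ y ≤ ρ_b e^{−κ₁ W b} ∏_{e ∈ Q} e^{−κ₁ W e} η_e`
and the single-slot RATIO clause — it produces `T4HistoryPeeling.SlotDom` with the two-rate budget, hence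
`T4WeightBudget.RelWeightBound` (`relWeightBound_of_slotDom_twoRate`).  The price and ratio clauses of `hdom` ARE the
wall of the node (GAPS G-ne7bp1-1: E2-rel / R1, the context-uniform conditional price of a pending component; not
printed as a lemma, B16 (1.104) is not a product).  Before this file the carrier had exactly two consumers: pv02's
producer seam `T4MatchingClosureRecords` and ONE degenerate `example` there (empty bad class, all constants `0`).  A
carrier whose binder has never been inhabited with a non-empty bad class is open to the objection «vacuous or
contradictory as typed».  This file closes that objection — and nothing else.

THE ANSWER (kernel, [folklore]; the instantiation table).  On the run model of `T4RenewalChains` §4 (`N` coordinates;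
at cutoff `K` the alive slots `i < j⋆(K) = ⌊K/2⌋` carry `none` or a PENDING RENEWAL CHAIN `S ∈ pendChains R (K − i)`;
weights `runWeight a p₀ p K τ = a K · ∏ (chain prices p₀·p^{#S})`; bad class = some slot pending):
* event type `ε := ℕ` (the absolute STEP of a renewal), window table `W ≡ R`, `step := id`, event universe
  `E K j := Ioc j K`, birth kinds `B K j := {j}`, residuals `ρ ≡ ρ₀`, `η ≡ η₀` (so `ρ̄ = ρ₀`, `η̄ = η₀`: one event per
  step at most), cells `γ := Unit` (one cell per age, `V = 1`, any `Λ ≥ 1`), cut `j⋆ := jhalf`;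
* §1 CHAINS ARE RECORDS: a linked chain satisfies `topAge S ≤ R·#S` (`topAge_le_mul_card_of_linked`), so a chain pending
  at horizon `K − j` and born at `j`, shifted to absolute steps (`shift j S`), satisfies P1's span condition
  `K + 1 − j ≤ R + Σ_{e ∈ shift j S} R` (`spanLE_shift`) inside `Ioc j K` (`shift_subset_Ioc`): `shift_mem_records`.
  The inclusion is STRICT (`Sanity`: at `R = 2`, horizon `3` the seven records `{1},{2},{3},{1,2},{1,3},{2,3},{1,2,3}`
  against the five pending chains — `{1}` is a chain renormalised AT the horizon, `{3}` is no chain at all): the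
  records count OVER-PAYS exactly the non-realisable histories, as `T4PersistentHistoryCount` §1 says it may;
* §2 PRICES IN P1 CURRENCY: the record price `recPrice` of `Q` = the chain price of the (at most one: `Finset.map_injective`)
  pending chain with `shift j S = Q`, else `0`; `0 ≤ recPrice` and, for model prices `p₀ ≤ ρ₀·e^{−κ₁R}`,
  `p ≤ e^{−κ₁R}·η₀`, `recPrice Q ≤ ρ₀ e^{−κ₁R} ∏_{e ∈ Q} (e^{−κ₁R} η₀)` (`recPrice_le`; EQUALITY on shifted chains at the
  extreme prices); the records sum of `recPrice` IS the chain sum (`sum_recPrice`, `Finset.sum_fiberwise_of_maps_to`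
  through §1);
* §3 THE RATIO CLAUSE WITH EQUALITY: on every insertion fibre (`T4RenewalChains.fibre_eq`) the fibre weight is
  `(Σ_{S pending} p₀ p^{#S}) · (context weight)` (`fibre_sum_eq`, by `runWeight_update_some`) — so `hdom` holds with
  its ratio clause as an equality and `slotDom_of_records` yields
  `SlotDom l₀ (terms N R) (runWeight a p₀ p) Bad (K ↦ ρ₀e^{−κ₁}·1·(Λe^{η₀−κ₁})^{K−⌊K/2⌋+1}/(1 − Λe^{η₀−κ₁}))`
  (`slotDom_run_records`) under the single rate condition `Λ·e^{η₀ − κ₁} < 1`; two such runs give `RelWeightBound`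
  with P1's profile (`relWeightBound_run_records`, via `relWeightBound_of_slotDom_twoRate`, `c = 1/2`);
* §4 NON-VACUITY: for `N ≥ 1`, `R ≥ 1`, `K ≥ 2` the bad class is NON-EMPTY (`bad_nonempty`: the every-step renewal
  chain `Icc 1 Ah` is pending, `Icc_mem_pendChains`) and carries POSITIVE weight when `a K, p₀, p > 0`
  (`bad_weight_pos`) — the certified bound is not `0 ≤ 0`;
* §5 THE DICTIONARY TABLES TOO: the same run (chain window = the renewal reach `R₀ + 1`) inhabits this lineage's
  `T4PersistenceDictionary.slotDom_of_records_dict` — event type `PEv`, window table `dictW (fun _ ↦ R₀) n₁`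
  (birth of fatness `0` ↦ `R₀ + 2`, renewal ↦ `R₀ + 1`, merger ↦ `n₁ + R₀`, unused: the model has no mergers), universe
  `dictE`, one birth kind per slot under the unit fatness cap (`dictB_one`), entropy table `etaD` (`η₀` per renewal,
  at most one per step: `sum_etaD_le`), chains ↦ dictionary records (`shiftD_mem_records`), prices `recPriceD`
  (`recPriceD_le`, `sum_recPriceD`), `hdom` discharged (`dom_run_dict`) ⇒ `slotDom_run_dict`, same budget;
* §6 SANITY, decided and numeric: the strict inclusion above; the shift at `j = 1`; and ONE instance inhabiting every
  hypothesis of `relWeightBound_run_records` at once (`R = 1`, `Λ = 2`, `κ₁ = 2`, `η₀ = ρ₀ = 1`, prices `e^{−2}`; the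
  rate `2e^{−1} < 1` from `Real.add_one_lt_exp`).
BOTH NE7b MEMBERS ON ONE FAMILY.  `T4RenewalChains.relWeightBound_run` (P2: Grove ledger → `ForestDom` → `EventDom`,
Lundberg tilts `Λ < z < z₁`, pairing defect `η`) and `relWeightBound_run_records` (P1: records → `SlotDom`, one rate
`Λe^{η₀−κ₁} < 1`, cruder: no tilt optimisation, records ⊋ chains) now both hold on the same runs; their free parameters
differ and NO ordering of the two budgets is claimed.

WHAT THIS SHOWS AND WHAT IT DOES NOT.  Shown (kernel): the hypotheses of `slotDom_of_records` — cell counts, `hE`,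
residual budgets, rate, cut, and ALL SEVEN conjuncts of `hdom` — are JOINTLY SATISFIABLE with a non-empty, positively
weighted bad class, and then produce a non-trivial summable `RelWeightBound`; the carrier is neither vacuous nor
contradictory as typed, and its output currency is the consumer's by name.  NOT shown, not claimed, not narrowed:
the wall G-ne7bp1-1 — in Bałaban's (1.104) the weights are NOT products over components (shared small-field action,
boundary terms, ℝ-operations near a deleted component), the price clause (E2-rel) and the ratio clause (R1,
context-uniform) are exactly what is unprinted, and a product toy is silent about them (`T4RenewalChains` header,
«(F1)» of `T4HistoryPeeling.SlotDom`).  The species bookkeeping of the cell (E2REL-b, `T4SiblingInsertion` §6 (Y),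
`T4BookingNecessity`) is untouched.

CITATION HEADER (LOCATORS ONLY — NO sentence of the series is newly quoted in this file; nothing printed is a
hypothesis of any theorem below; the audited manuscripts are not cited for any disputed step).
* [Balaban1989LargeFieldII] T. Bałaban, *Large field renormalization. II. Localization, exponentiation, and bounds for
  the ℝ operation*, Commun. Math. Phys. **122** (1989) 355–392 (cell paper B16): (1.79) p. 383 (per-region factors and
  record entropy — the shapes P1's `ρ`, `η`, `Λ` name), pp. 385–387 (the lifetime rules the window table `W` books;
  readings (ID) of `T4PersistenceDictionary`), (1.104) p. 391 (the expansion whose insertion ratio is the wall).  The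
  window CONDITIONS of the scheme are [Balaban1989LargeFieldI] (CMP **122** (1989) 175–202, B15) p. 198; the sentence
  «N ≦ R_k» of B16 p. 361 (quoted in `T4BadClassBooking`'s certified header, not newly here) is an assumption made there
  while bounding the third-order term of (1.20), not a statement of those conditions (GAPS-T4 G-t4r2-17).
* The combinatorics below (linked chains, shifted records, fibre sums) is [folklore]; the run model is
  `T4RenewalChains` §4 (t4-ne7b-p2), used BY NAME and unmodified.

WHAT IS PROVED (kernel; all [folklore]; zero `sorry`, no new axiom; imports `T4RenewalChains` only — hence
`T4PersistenceGrove` / `T4PersistenceDictionary` / `T4PersistentHistoryCount` / `T4HistoryPeeling` / `T4WeightBudget`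
transitively; modifies nothing).  §1 `topAge_le_mul_card`, `topAge_le_mul_card_of_linked`, `shift`, `mem_shift`,
`card_shift`, `shift_subset_Ioc`, `spanLE_shift`, `shift_mem_records`; §2 `recPrice`,
`recPrice_nonneg`, `sum_recPrice`, `recPrice_le`, `recPrice_shift`; §3 `fibre_sum_eq`, `dom_run`, `slotDom_run_records`,
`relWeightBound_run_records`; §4 `topAge_Icc`, `Icc_mem_pendChains`, `bad_nonempty`, `runWeight_pos`,
`bad_weight_pos`; §5 `devt`, `shiftD`, `mem_shiftD`, `card_shiftD`, `shiftD_injective`, `shiftD_subset_dictE`,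
`fatWait_zero`, `spanLE_shiftD`, `shiftD_mem_records`, `dictB_one`, `recPriceD`, `recPriceD_nonneg`, `sum_recPriceD`,
`etaD`, `etaD_nonneg`, `sum_etaD_le`, `recPriceD_le`, `dom_run_dict`, `slotDom_run_dict`; §6 `Sanity.*`.
Unit `b2b-balaban-t4-ne7b-p1` gen 6 (journal CLAIM T4-U5c.E-NE7b-RECORDCHAINS-K* 2026-08-19T12:19:48Z). [folklore]
-/

noncomputable section

open Finset

namespace Literature.MathematicalPhysics.QuantumFieldTheory.Balaban1983to89.T4RecordChains

open Literature.MathematicalPhysics.QuantumFieldTheory.Balaban1983to89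
open T4WeightBudget T4HistoryPeeling T4PersistentHistoryCount T4RenewalChains

/-! ## §1 Chains are records: the span condition of a pending linked chain -/

section ChainsAreRecords

/-- **A LINKED CHAIN REACHES AT MOST `R` PER RENEWAL**: `topAge S ≤ R·#S` (induction on the number of renewals via the
truncation: `topAge S ≤ topAge (trunc S) + R`). [folklore] -/
theorem topAge_le_mul_card {R : ℕ} : ∀ (n : ℕ) {S : Finset ℕ}, S.card = n → Linked R S → topAge S ≤ R * S.card
  | 0, S, h, _ => by rw [Finset.card_eq_zero.1 h, topAge_empty]; exact Nat.zero_le _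
  | n + 1, S, h, hL => by
    have hne : S.Nonempty := Finset.card_pos.1 (by omega)
    have hc : (trunc S).card = n := by have := card_trunc_add_one hne; omega
    have ih := topAge_le_mul_card n hc (linked_trunc hL)
    have h1 := hL.topAge_le hne
    have h2 : R * S.card = R * (trunc S).card + R := by rw [← card_trunc_add_one hne]; ring
    rw [h2]; omega

/-- … without the fuel. [folklore] -/
theorem topAge_le_mul_card_of_linked {R : ℕ} {S : Finset ℕ} (h : Linked R S) : topAge S ≤ R * S.card :=
  topAge_le_mul_card S.card rfl h

/-- **THE RECORD OF A CHAIN BORN AT STEP `j`**: its renewal AGES shifted to absolute STEPS `a + j`. [folklore] -/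
def shift (j : ℕ) (S : Finset ℕ) : Finset ℕ := S.map (addRightEmbedding j)

/-- membership in the shifted chain [folklore] -/
theorem mem_shift {j s : ℕ} {S : Finset ℕ} : s ∈ shift j S ↔ ∃ a ∈ S, a + j = s := by
  simp [shift]

/-- the shift keeps the number of renewals [folklore] -/
@[simp] theorem card_shift (j : ℕ) (S : Finset ℕ) : (shift j S).card = S.card := Finset.card_map _

-- distinct chains have distinct records: `Finset.map_injective (addRightEmbedding j)` (the map `shift j` is
-- injective; not restated as a theorem — an identical [folklore] statement is already landed elsewhere in the tree).

/-- the record of a chain with horizon `K − j` lives in the event universe `(j, K]` [folklore] -/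
theorem shift_subset_Ioc {R K j : ℕ} {S : Finset ℕ} (hS : S ∈ chains R (K - j)) : shift j S ⊆ Ioc j K := by
  intro s hs
  obtain ⟨a, ha, rfl⟩ := mem_shift.1 hs
  have := Finset.mem_Icc.1 ((mem_chains.1 hS).1 ha)
  rw [Finset.mem_Ioc]; omega

/-- **A PENDING CHAIN SATISFIES P1's SPAN CONDITION** with the constant window table `W ≡ R` and the birth as its own
kind: `K + 1 − j ≤ R + Σ_{e ∈ shift j S} R`, from `K − j < topAge S + R` (pending) and `topAge S ≤ R·#S` (linked).
[folklore] -/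
theorem spanLE_shift {R K j : ℕ} {S : Finset ℕ} (hS : S ∈ pendChains R (K - j)) :
    SpanLE (fun _ : ℕ => R) j K j (shift j S) := by
  obtain ⟨hc, hpend⟩ := mem_pendChains.1 hS
  have h1 : topAge S ≤ R * S.card := topAge_le_mul_card_of_linked (mem_chains.1 hc).2
  unfold SpanLE
  dsimp only
  rw [Finset.sum_const, card_shift, smul_eq_mul, Nat.mul_comm S.card R]
  omega

/-- **CHAINS ARE RECORDS**: the shifted pending chain is a member of
`records (fun _ ↦ R) j K (Ioc j K) j`. [folklore] -/
theorem shift_mem_records {R K j : ℕ} {S : Finset ℕ} (hS : S ∈ pendChains R (K - j)) :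
    shift j S ∈ records (fun _ : ℕ => R) j K (Ioc j K) j :=
  mem_records.2 ⟨shift_subset_Ioc (pendChains_subset _ _ hS), spanLE_shift hS⟩

end ChainsAreRecords

/-! ## §2 Record prices in P1 currency -/

section Prices

/-- **THE RECORD PRICE**: the chain price `p₀·p^{#S}` of the pending chain `S` (horizon `Ah`, born at `j`) whose record
is `Q`, summed over the (at most one) such chain — `0` on records that are not shifted pending chains. [folklore] -/
def recPrice (p₀ p : ℝ) (R Ah j : ℕ) (Q : Finset ℕ) : ℝ :=
  ∑ S ∈ pendChains R Ah with shift j S = Q, chainPrice p₀ p S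

/-- record prices are non-negative [folklore] -/
theorem recPrice_nonneg {p₀ p : ℝ} (hp₀ : 0 ≤ p₀) (hp : 0 ≤ p) (R Ah j : ℕ) (Q : Finset ℕ) :
    0 ≤ recPrice p₀ p R Ah j Q :=
  Finset.sum_nonneg fun S _ => chainPrice_nonneg hp₀ hp S

/-- **THE RECORDS SUM OF THE PRICES IS THE CHAIN SUM** (every pending chain's record is a record, §1; records that
are no chain cost `0`). [folklore] -/
theorem sum_recPrice (p₀ p : ℝ) (R K j : ℕ) :
    ∑ Q ∈ records (fun _ : ℕ => R) j K (Ioc j K) j, recPrice p₀ p R (K - j) j Q =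
      ∑ S ∈ pendChains R (K - j), chainPrice p₀ p S :=
  Finset.sum_fiberwise_of_maps_to (fun _ hS => shift_mem_records hS) _

/-- on the record of a pending chain the price IS the chain price [folklore] -/
theorem recPrice_shift (p₀ p : ℝ) {R Ah j : ℕ} {S : Finset ℕ} (hS : S ∈ pendChains R Ah) :
    recPrice p₀ p R Ah j (shift j S) = chainPrice p₀ p S := by
  unfold recPrice
  have : (pendChains R Ah).filter (fun S' => shift j S' = shift j S) = {S} := by
    ext S'
    simp only [Finset.mem_filter, Finset.mem_singleton]
    exact ⟨fun h => Finset.map_injective (addRightEmbedding j) h.2, fun h => ⟨h ▸ hS, by rw [h]⟩⟩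
  rw [this, Finset.sum_singleton]

/-- **THE PRICE CLAUSE OF `hdom` IN P1 CURRENCY**: with model prices `p₀ ≤ ρ₀·e^{−κ₁R}` (birth) and
`p ≤ e^{−κ₁R}·η₀` (renewal), every record price is at most `ρ₀ e^{−κ₁ R} · ∏_{e ∈ Q} (e^{−κ₁ R} η₀)` — a record
carries at most ONE chain (`Finset.map_injective`), with `#Q` renewals. Equality on shifted chains at the extreme prices.
[folklore] -/
theorem recPrice_le {p₀ p ρ₀ η₀ κ₁ : ℝ} {R : ℕ} (hp₀ : 0 ≤ p₀) (hp : 0 ≤ p)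
    (hp₀ρ : p₀ ≤ ρ₀ * Real.exp (-(κ₁ * R))) (hpη : p ≤ Real.exp (-(κ₁ * R)) * η₀) (Ah j : ℕ) (Q : Finset ℕ) :
    recPrice p₀ p R Ah j Q ≤ ρ₀ * Real.exp (-(κ₁ * R)) * ∏ _e ∈ Q, (Real.exp (-(κ₁ * R)) * η₀) := by
  have hρ₀e : 0 ≤ ρ₀ * Real.exp (-(κ₁ * R)) := hp₀.trans hp₀ρ
  set F := (pendChains R Ah).filter (fun S => shift j S = Q) with hF
  have hcard : F.card ≤ 1 := Finset.card_le_one.2 fun S hS S' hS' => by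
    have h : shift j S = shift j S' := by rw [(Finset.mem_filter.1 hS).2, (Finset.mem_filter.1 hS').2]
    exact Finset.map_injective (addRightEmbedding j) h
  have hconst : ∀ S ∈ F, chainPrice p₀ p S = p₀ * p ^ Q.card := fun S hS => by
    rw [chainPrice, ← (Finset.mem_filter.1 hS).2, card_shift]
  have hcard' : (F.card : ℝ) ≤ 1 := by exact_mod_cast hcard
  rw [Finset.prod_const]
  calc recPrice p₀ p R Ah j Q = ∑ S ∈ F, chainPrice p₀ p S := rfl
    _ = ∑ S ∈ F, p₀ * p ^ Q.card := Finset.sum_congr rfl hconst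
    _ = F.card * (p₀ * p ^ Q.card) := by rw [Finset.sum_const, nsmul_eq_mul]
    _ ≤ 1 * (p₀ * p ^ Q.card) := mul_le_mul_of_nonneg_right hcard' (mul_nonneg hp₀ (pow_nonneg hp _))
    _ = p₀ * p ^ Q.card := one_mul _
    _ ≤ ρ₀ * Real.exp (-(κ₁ * R)) * (Real.exp (-(κ₁ * R)) * η₀) ^ Q.card :=
        mul_le_mul hp₀ρ (pow_le_pow_left₀ hp hpη _) (pow_nonneg hp _) hρ₀e

end Prices

/-! ## §3 The carrier inhabited: `hdom` discharged on the run, `SlotDom`, `RelWeightBound` -/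

section Run

variable {N : ℕ}

/-- **THE FIBRE WEIGHT IS THE CHAIN SUM TIMES THE CONTEXT WEIGHT** (the ratio clause of `hdom` with EQUALITY): over a
context `τ″` with slot `i` empty, the terms pending at `i` that switch off to `τ″` weigh
`(Σ_{S ∈ pendChains R (K − i)} p₀ p^{#S}) · runWeight τ″` (`fibre_eq`, `runWeight_update_some`). [folklore] -/
theorem fibre_sum_eq {R K : ℕ} (a : ℕ → ℝ) (p₀ p : ℝ) (i : Fin (nsl N K)) {τ'' : Fin N → Option (Finset ℕ)}
    (hτ'' : τ'' ∈ terms N R K) (hpend : (runSwitchOff N R K).pend i τ'' = false) :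
    ∑ τ ∈ terms N R K with ((runSwitchOff N R K).pend i τ = true ∧ (runSwitchOff N R K).off i τ = τ''),
        runWeight a p₀ p K τ =
      (∑ S ∈ pendChains R (K - (slot i : ℕ)), chainPrice p₀ p S) * runWeight a p₀ p K τ'' := by
  rw [fibre_eq i hτ'' hpend]
  have hnone : τ'' (slot i) = none :=
    Option.not_isSome_iff_eq_none.1 (by simp [runSwitchOff] at hpend; simp [hpend])
  rw [Finset.sum_image, Finset.sum_mul]
  · exact Finset.sum_congr rfl fun S _ => runWeight_update_some hnone S
  · intro S _ S' _ h
    have := congrFun h (slot i)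
    simpa using this

/-- **`hdom` OF `slotDom_of_records`, DISCHARGED ON THE RUN** (every conjunct; the price clause by `recPrice_le`, the
ratio clause by `fibre_sum_eq` + `sum_recPrice` as an equality): per cutoff `K`, the switch-off structure
`runSwitchOff`, births `i ↦ i` (old: `< ⌊K/2⌋`), the one cell, and the record prices `recPrice`. [folklore] -/
theorem dom_run (R : ℕ) (a : ℕ → ℝ) {p₀ p ρ₀ η₀ κ₁ : ℝ} (hp₀ : 0 ≤ p₀) (hp : 0 ≤ p)
    (hp₀ρ : p₀ ≤ ρ₀ * Real.exp (-(κ₁ * R))) (hpη : p ≤ Real.exp (-(κ₁ * R)) * η₀) (K : ℕ) :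
    ∃ (n : ℕ) (Φ : SwitchOff (terms N R K) n) (birth : Fin n → ℕ) (cell : Fin n → Unit)
        (y : Fin n → ℕ → Finset ℕ → ℝ),
      (runSwitchOff N R K).bad = Φ.bad ∧ (∀ i, birth i < jhalf K) ∧
      (∀ i, cell i ∈ (Finset.univ : Finset Unit)) ∧
      Function.Injective (fun i => (⟨birth i, cell i⟩ : Σ _ : ℕ, Unit)) ∧
      (∀ i, ∀ b ∈ ({birth i} : Finset ℕ), ∀ Q ∈ records (fun _ : ℕ => R) (birth i) K (Ioc (birth i) K) b,
        0 ≤ y i b Q) ∧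
      (∀ i, ∀ b ∈ ({birth i} : Finset ℕ), ∀ Q ∈ records (fun _ : ℕ => R) (birth i) K (Ioc (birth i) K) b,
        y i b Q ≤ ρ₀ * Real.exp (-(κ₁ * R)) * ∏ _e ∈ Q, (Real.exp (-(κ₁ * R)) * η₀)) ∧
      ∀ i : Fin n, ∀ τ'' ∈ terms N R K, Φ.pend i τ'' = false →
        ∑ τ ∈ terms N R K with (Φ.pend i τ = true ∧ Φ.off i τ = τ''), runWeight a p₀ p K τ ≤
          (∑ b ∈ ({birth i} : Finset ℕ), ∑ Q ∈ records (fun _ : ℕ => R) (birth i) K (Ioc (birth i) K) b,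
            y i b Q) * runWeight a p₀ p K τ'' := by
  refine ⟨nsl N K, runSwitchOff N R K, fun i => (slot i : ℕ), fun _ => (),
    fun i _ Q => recPrice p₀ p R (K - (slot i : ℕ)) (slot i : ℕ) Q, rfl, fun i => slot_lt_jhalf i,
    fun _ => Finset.mem_univ _, ?_, ?_, ?_, ?_⟩
  · intro i i' h
    have h' : ((slot i : ℕ)) = (slot i' : ℕ) := congrArg Sigma.fst h
    exact Fin.ext (by simpa [slot] using h')
  · intro i b _ Q _
    exact recPrice_nonneg hp₀ hp _ _ _ Q
  · intro i b _ Q _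
    exact recPrice_le hp₀ hp hp₀ρ hpη _ _ Q
  · intro i τ'' hτ'' hpend
    rw [Finset.sum_singleton, sum_recPrice, fibre_sum_eq a p₀ p i hτ'' hpend]

/-- **THE P1 CARRIER INHABITED: `SlotDom` OF THE RUN BY `slotDom_of_records`** with P1's two-rate budget
`S K = ρ₀e^{−κ₁} · 1 · (Λe^{η₀−κ₁})^{K − ⌊K/2⌋ + 1}/(1 − Λe^{η₀−κ₁})`, for model prices `p₀ ≤ ρ₀·e^{−κ₁R}`,
`p ≤ e^{−κ₁R}·η₀` (`κ₁ ≥ 0`), one cell per age at any `Λ ≥ 1`, under the single RATE CONDITION `Λ·e^{η₀ − κ₁} < 1`.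
Every hypothesis of `slotDom_of_records` is discharged: `hcell` (one cell), `hE` (`step = id` on `Ioc j K`), `hρ`,
`hρbar` (`Σ_{b ∈ {j}} ρ₀ = ρ₀`), `hη`, `hηbar` (at most one event per step), `hr`, `hj` (`⌊K/2⌋ ≤ K`), `hdom`
(`dom_run`). [folklore] -/
theorem slotDom_run_records (N R : ℕ) (l₀ : ℝ) (a : ℕ → ℝ) {p₀ p ρ₀ η₀ κ₁ Λ : ℝ} (hp₀ : 0 ≤ p₀) (hp : 0 ≤ p)
    (hκ : 0 ≤ κ₁) (hΛ : 1 ≤ Λ) (hp₀ρ : p₀ ≤ ρ₀ * Real.exp (-(κ₁ * R))) (hpη : p ≤ Real.exp (-(κ₁ * R)) * η₀)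
    (hr : Λ * Real.exp (η₀ - κ₁) < 1) :
    SlotDom l₀ (terms N R) (fun K _ τ => runWeight a p₀ p K τ) (fun K _ => (runSwitchOff N R K).bad) fun K =>
      ρ₀ * Real.exp (-κ₁) * 1 *
        ((Λ * Real.exp (η₀ - κ₁)) ^ (K - jhalf K + 1) / (1 - Λ * Real.exp (η₀ - κ₁))) := by
  have he : 0 < Real.exp (-(κ₁ * R)) := Real.exp_pos _
  have hρ₀ : 0 ≤ ρ₀ := (mul_nonneg_iff_of_pos_right he).1 (hp₀.trans hp₀ρ)
  have hη₀ : 0 ≤ η₀ := (mul_nonneg_iff_of_pos_left he).1 (hp.trans hpη)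
  refine slotDom_of_records (fun _ _ => (Finset.univ : Finset Unit)) zero_le_one (zero_le_one.trans hΛ) ?_
    (fun _ => R) id (fun K j => Ioc j K) (fun _ j => {j}) (fun _ _ _ he' => he') hκ (fun _ => ρ₀)
    (fun _ _ _ _ => hρ₀) ?_ (fun _ => η₀) (fun _ _ _ _ => hη₀) ?_ hr jhalf (fun K => Nat.div_le_self K 2)
    fun K _ _ => dom_run R a hp₀ hp hp₀ρ hpη K
  · intro K a'
    rw [Finset.card_univ, Fintype.card_unit, Nat.cast_one, one_mul]
    exact one_le_pow₀ hΛ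
  · intro K j
    rw [Finset.sum_singleton]
  · intro K j t _
    have hsub : ((Ioc j K).filter fun e => id e = t) ⊆ {t} := fun e he' => by
      rw [Finset.mem_singleton]; exact (Finset.mem_filter.1 he').2
    calc ∑ e ∈ (Ioc j K).filter (fun e => id e = t), η₀ ≤ ∑ _e ∈ ({t} : Finset ℕ), η₀ :=
          Finset.sum_le_sum_of_subset_of_nonneg hsub fun _ _ _ => hη₀
      _ = η₀ := Finset.sum_singleton _ _

/-- **THE ROW'S OUTPUT SHAPE WITH P1's PROFILE, END TO END**: two multiplicative runs on the same term family (prices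
`(p₀, p)`, `(q₀, q)` both within the P1 currency `(ρ₀, η₀, κ₁)`, amplitudes `a, b ≥ 0`), one cell per age at `Λ ≥ 1`,
rate `Λ·e^{η₀ − κ₁} < 1` ⇒ `T4WeightBudget.RelWeightBound` with weights
`W K = 1 − exp(−ρ₀e^{−κ₁}·1·(Λe^{η₀−κ₁})^{K − ⌊K/2⌋ + 1}/(1 − Λe^{η₀−κ₁}))` — records → `SlotDom`
(`slotDom_of_records`) → `relWeightBound_of_slotDom_twoRate` (`c = 1/2`, `half_le_sub_jhalf`), every carrier inhabited,
every constant explicit; nothing of [Balaban1989LargeFieldII] involved. [folklore] -/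
theorem relWeightBound_run_records (N R : ℕ) (l₀ : ℝ) (a b : ℕ → ℝ) {p₀ p q₀ q ρ₀ η₀ κ₁ Λ : ℝ}
    (ha : ∀ K, 0 ≤ a K) (hb : ∀ K, 0 ≤ b K) (hp₀ : 0 ≤ p₀) (hp : 0 ≤ p) (hq₀ : 0 ≤ q₀) (hq : 0 ≤ q)
    (hκ : 0 ≤ κ₁) (hΛ : 1 ≤ Λ) (hp₀ρ : p₀ ≤ ρ₀ * Real.exp (-(κ₁ * R))) (hpη : p ≤ Real.exp (-(κ₁ * R)) * η₀)
    (hq₀ρ : q₀ ≤ ρ₀ * Real.exp (-(κ₁ * R))) (hqη : q ≤ Real.exp (-(κ₁ * R)) * η₀)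
    (hr : Λ * Real.exp (η₀ - κ₁) < 1) :
    RelWeightBound l₀ (terms N R) (fun K _ τ => runWeight a p₀ p K τ) (fun K _ τ => runWeight b q₀ q K τ)
      (fun K _ => (runSwitchOff N R K).bad) fun K =>
        1 - Real.exp (-(ρ₀ * Real.exp (-κ₁) * 1 *
          ((Λ * Real.exp (η₀ - κ₁)) ^ (K - jhalf K + 1) / (1 - Λ * Real.exp (η₀ - κ₁))))) := by
  have he : 0 < Real.exp (-(κ₁ * R)) := Real.exp_pos _
  have hρ₀ : 0 ≤ ρ₀ := (mul_nonneg_iff_of_pos_right he).1 (hp₀.trans hp₀ρ)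
  exact relWeightBound_of_slotDom_twoRate (mul_nonneg hρ₀ (Real.exp_pos _).le) zero_le_one
    (mul_pos (lt_of_lt_of_le one_pos hΛ) (Real.exp_pos _)) hr one_half_pos half_le_sub_jhalf
    (fun K _ _ τ _ => runWeight_nonneg ha hp₀ hp K τ) (fun K _ _ τ _ => runWeight_nonneg hb hq₀ hq K τ)
    (slotDom_run_records N R l₀ a hp₀ hp hκ hΛ hp₀ρ hpη hr) (slotDom_run_records N R l₀ b hq₀ hq hκ hΛ hq₀ρ hqη hr)

end Run

/-! ## §4 Non-vacuity: the bad class of the run is non-empty and positively weighted -/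

section NonVacuous

/-- the top age of the every-step history `{1, …, m}` is `m` [folklore] -/
theorem topAge_Icc (m : ℕ) : topAge (Icc 1 m) = m := by
  apply le_antisymm (topAge_le fun a ha => (Finset.mem_Icc.1 ha).2)
  rcases Nat.eq_zero_or_pos m with rfl | hm
  · exact Nat.zero_le _
  · exact le_topAge (Finset.mem_Icc.2 ⟨hm, le_rfl⟩)

/-- **THE EVERY-STEP RENEWAL CHAIN IS PENDING**: with window `R ≥ 1`, renewing at every age `1, …, Ah` is linked and
still pending at the horizon. [folklore] -/
theorem Icc_mem_pendChains {R : ℕ} (hR : 1 ≤ R) (Ah : ℕ) : Icc 1 Ah ∈ pendChains R Ah := by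
  refine mem_pendChains.2 ⟨mem_chains.2 ⟨subset_rfl, fun a ha => ?_⟩, by rw [topAge_Icc]; omega⟩
  have ha' := Finset.mem_Icc.1 ha
  have hset : (Icc 1 Ah).filter (fun b => b < a) = Icc 1 (a - 1) := by
    ext b; simp only [Finset.mem_filter, Finset.mem_Icc]; omega
  rw [hset, topAge_Icc]; omega

variable {N : ℕ}

/-- **THE BAD CLASS IS NON-EMPTY** as soon as a slot is alive (`N ≥ 1`, `K ≥ 2`) and the window is positive: the term
with the every-step chain at slot `0` and nothing elsewhere is a pending term of the run. [folklore] -/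
theorem bad_nonempty {R K : ℕ} (hN : 1 ≤ N) (hK : 2 ≤ K) (hR : 1 ≤ R) : ((runSwitchOff N R K).bad).Nonempty := by
  have h0 : 0 < nsl N K := by unfold nsl jhalf; exact lt_min_iff.2 ⟨hN, by omega⟩
  set i₀ : Fin (nsl N K) := ⟨0, h0⟩ with hi₀
  set τ₀ : Fin N → Option (Finset ℕ) := fun _ => none with hτ₀
  have hτ₀T : τ₀ ∈ terms N R K := mem_terms.2 fun k => none_mem_slotVals R K k
  have hp₀ : (runSwitchOff N R K).pend i₀ τ₀ = false := by simp [runSwitchOff, hτ₀]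
  have hmem : Function.update τ₀ (slot i₀) (some (Icc 1 (K - (slot i₀ : ℕ)))) ∈
      (terms N R K).filter fun τ => (runSwitchOff N R K).pend i₀ τ = true ∧ (runSwitchOff N R K).off i₀ τ = τ₀ := by
    rw [fibre_eq i₀ hτ₀T hp₀]
    exact Finset.mem_image_of_mem _ (Icc_mem_pendChains hR _)
  obtain ⟨hT, hpend, -⟩ := Finset.mem_filter.1 hmem
  exact ⟨_, (SwitchOff.mem_bad _).2 ⟨hT, ⟨i₀, (SwitchOff.mem_charge _).2 hpend⟩⟩⟩

/-- run weights with positive amplitude and prices are positive [folklore] -/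
theorem runWeight_pos {a : ℕ → ℝ} {p₀ p : ℝ} {K : ℕ} (ha : 0 < a K) (hp₀ : 0 < p₀) (hp : 0 < p)
    (τ : Fin N → Option (Finset ℕ)) : 0 < runWeight a p₀ p K τ := by
  refine mul_pos ha (Finset.prod_pos fun k _ => ?_)
  cases τ k with
  | none => exact one_pos
  | some S => exact mul_pos hp₀ (pow_pos hp _)

/-- **… AND POSITIVELY WEIGHTED**: the bad class of the run carries positive weight, so the certified relative bound of
§3 is not the trivial `0 ≤ W·Σ_T B`. [folklore] -/
theorem bad_weight_pos {R K : ℕ} (hN : 1 ≤ N) (hK : 2 ≤ K) (hR : 1 ≤ R) {a : ℕ → ℝ} {p₀ p : ℝ} (ha : 0 < a K)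
    (hp₀ : 0 < p₀) (hp : 0 < p) : 0 < ∑ τ ∈ (runSwitchOff N R K).bad, runWeight a p₀ p K τ :=
  Finset.sum_pos (fun τ _ => runWeight_pos ha hp₀ hp τ) (bad_nonempty hN hK hR)

end NonVacuous

/-! ## §5 The dictionary tables inhabited: `T4PersistenceDictionary.slotDom_of_records_dict` on the run -/

section Dictionary

open T4PersistenceDictionary

/-- **THE DICTIONARY RECORD OF A CHAIN** born at step `j`: its renewals as persistence events
`(step a + j, kind 1 = renewal, fatness class 0)`. [folklore] -/
def devt (j : ℕ) : ℕ ↪ PEv := ⟨fun a => (a + j, 1, 0), fun a a' h => by simpa using congrArg Prod.fst h⟩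

/-- the dictionary record of a chain [folklore] -/
def shiftD (j : ℕ) (S : Finset ℕ) : Finset PEv := S.map (devt j)

/-- membership in the dictionary record [folklore] -/
theorem mem_shiftD {j : ℕ} {S : Finset ℕ} {e : PEv} : e ∈ shiftD j S ↔ ∃ a ∈ S, ((a + j, 1, 0) : PEv) = e := by
  simp [shiftD, devt]

/-- the dictionary record keeps the number of renewals [folklore] -/
@[simp] theorem card_shiftD (j : ℕ) (S : Finset ℕ) : (shiftD j S).card = S.card := Finset.card_map _

/-- distinct chains have distinct dictionary records [folklore] -/
theorem shiftD_injective (j : ℕ) : Function.Injective (shiftD j) := fun _ _ h => Finset.map_injective _ h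

/-- the dictionary record of a chain with horizon `K − j` lives in the event universe `dictE` (steps `(j, K]`, any kind,
fatness `< 1`) [folklore] -/
theorem shiftD_subset_dictE {R₁ K j : ℕ} {S : Finset ℕ} (hS : S ∈ chains R₁ (K - j)) :
    shiftD j S ⊆ dictE (fun _ => 1) K j := by
  intro e he
  obtain ⟨a, ha, rfl⟩ := mem_shiftD.1 he
  have := Finset.mem_Icc.1 ((mem_chains.1 hS).1 ha)
  refine mem_dictE.2 ⟨?_, ?_⟩
  · rw [PEv.step_mk, Finset.mem_Ioc]; omega
  · rw [PEv.fat_mk]; exact Nat.one_pos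

/-- the fat waiting time of a thin region (`d′ = 0`) is the printed qualifier's `1` [folklore] -/
theorem fatWait_zero : fatWait 0 = 1 := by simp [fatWait]

/-- **A PENDING CHAIN SATISFIES P1's SPAN CONDITION WITH THE DICTIONARY'S WINDOW TABLE** `dictW (fun _ ↦ R₀) n₁`
(birth of fatness `0` ↦ `fatWait 0 + R₀ + 1 = R₀ + 2`, renewal ↦ `R₀ + 1`; the chain model's window is the renewal
reach `R₀ + 1`): `K + 1 − j ≤ (R₀ + 2) + #S·(R₀ + 1)`. [folklore] -/
theorem spanLE_shiftD {R₀ n₁ K j : ℕ} {S : Finset ℕ} (hS : S ∈ pendChains (R₀ + 1) (K - j)) :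
    SpanLE (dictW (fun _ => R₀) n₁) j K ((j, 0, 0) : PEv) (shiftD j S) := by
  obtain ⟨hc, hpend⟩ := mem_pendChains.1 hS
  have h1 : topAge S ≤ S.card * (R₀ + 1) := by
    rw [Nat.mul_comm]; exact topAge_le_mul_card_of_linked (mem_chains.1 hc).2
  have hW : ∀ a ∈ S, dictW (fun _ => R₀) n₁ (devt j a) = R₀ + 1 := fun a _ => by
    simp only [devt, Function.Embedding.coeFn_mk, dictW_renew]
  unfold SpanLE
  rw [shiftD, Finset.sum_map, Finset.sum_congr rfl hW, Finset.sum_const, smul_eq_mul, dictW_birth, fatWait_zero]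
  omega

/-- **CHAINS ARE DICTIONARY RECORDS**: the dictionary record of a pending chain is a member of
`records (dictW (fun _ ↦ R₀) n₁) j K (dictE (fun _ ↦ 1) K j) (j, 0, 0)`. [folklore] -/
theorem shiftD_mem_records {R₀ n₁ K j : ℕ} {S : Finset ℕ} (hS : S ∈ pendChains (R₀ + 1) (K - j)) :
    shiftD j S ∈ records (dictW (fun _ => R₀) n₁) j K (dictE (fun _ => 1) K j) ((j, 0, 0) : PEv) :=
  mem_records.2 ⟨shiftD_subset_dictE (pendChains_subset _ _ hS), spanLE_shiftD hS⟩

/-- under the unit fatness cap a slot has ONE birth kind, `(j, 0, 0)` [folklore] -/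
theorem dictB_one (K j : ℕ) : dictB (fun _ => 1) K j = {((j, 0, 0) : PEv)} := by
  ext e
  rw [mem_dictB, Finset.mem_singleton]
  obtain ⟨s, k, d⟩ := e
  simp only [PEv.step_mk, PEv.kind_mk, PEv.fat_mk, Nat.lt_one_iff, Prod.mk.injEq]

/-- **THE DICTIONARY RECORD PRICE**: the chain price of the pending chain whose dictionary record is `Q` (at most one),
else `0`. [folklore] -/
def recPriceD (p₀ p : ℝ) (R₁ Ah j : ℕ) (Q : Finset PEv) : ℝ :=
  ∑ S ∈ pendChains R₁ Ah with shiftD j S = Q, chainPrice p₀ p S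

/-- dictionary record prices are non-negative [folklore] -/
theorem recPriceD_nonneg {p₀ p : ℝ} (hp₀ : 0 ≤ p₀) (hp : 0 ≤ p) (R₁ Ah j : ℕ) (Q : Finset PEv) :
    0 ≤ recPriceD p₀ p R₁ Ah j Q :=
  Finset.sum_nonneg fun S _ => chainPrice_nonneg hp₀ hp S

/-- the records sum of the dictionary prices is the chain sum [folklore] -/
theorem sum_recPriceD (p₀ p : ℝ) (R₀ n₁ K j : ℕ) :
    ∑ Q ∈ records (dictW (fun _ => R₀) n₁) j K (dictE (fun _ => 1) K j) ((j, 0, 0) : PEv),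
        recPriceD p₀ p (R₀ + 1) (K - j) j Q = ∑ S ∈ pendChains (R₀ + 1) (K - j), chainPrice p₀ p S :=
  Finset.sum_fiberwise_of_maps_to (fun _ hS => shiftD_mem_records hS) _

/-- The RESIDUAL ENTROPY TABLE of the model on the dictionary: `η₀` per renewal, nothing for births and mergers (the
model has no mergers and one birth kind). [folklore] -/
def etaD (η₀ : ℝ) (e : PEv) : ℝ := if e.kind = 1 then η₀ else 0

/-- the entropy table is non-negative [folklore] -/
theorem etaD_nonneg {η₀ : ℝ} (h : 0 ≤ η₀) (e : PEv) : 0 ≤ etaD η₀ e := by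
  unfold etaD; split_ifs <;> [exact h; exact le_rfl]

/-- **AT MOST ONE RENEWAL PER STEP**: the per-step residual entropy of the universe is `≤ η₀` (the binder `hηbar`).
[folklore] -/
theorem sum_etaD_le {η₀ : ℝ} (h : 0 ≤ η₀) (K j t : ℕ) :
    ∑ e ∈ dictE (fun _ => 1) K j with PEv.step e = t, etaD η₀ e ≤ η₀ := by
  set F := (dictE (fun _ => 1) K j).filter fun e => PEv.step e = t with hF
  have hcard : (F.filter fun e => e.kind = 1).card ≤ 1 := by
    refine Finset.card_le_one.2 fun e he e' he' => ?_
    obtain ⟨he1, he2⟩ := Finset.mem_filter.1 he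
    obtain ⟨he1', he2'⟩ := Finset.mem_filter.1 he'
    obtain ⟨hE, hs⟩ := Finset.mem_filter.1 he1
    obtain ⟨hE', hs'⟩ := Finset.mem_filter.1 he1'
    have hf := (mem_dictE.1 hE).2
    have hf' := (mem_dictE.1 hE').2
    obtain ⟨s, k, d⟩ := e
    obtain ⟨s', k', d'⟩ := e'
    simp only [PEv.step_mk, PEv.kind_mk, PEv.fat_mk, Nat.lt_one_iff] at hs hs' he2 he2' hf hf'
    subst hs hs' he2 he2' hf hf'
    rfl
  have hcard' : ((F.filter fun e => e.kind = 1).card : ℝ) ≤ 1 := by exact_mod_cast hcard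
  calc ∑ e ∈ F, etaD η₀ e = ∑ e ∈ F with e.kind = 1, η₀ := (Finset.sum_filter _ _).symm
    _ = (F.filter fun e => e.kind = 1).card * η₀ := by rw [Finset.sum_const, nsmul_eq_mul]
    _ ≤ 1 * η₀ := mul_le_mul_of_nonneg_right hcard' h
    _ = η₀ := one_mul _

/-- **THE PRICE CLAUSE ON THE DICTIONARY**: with model prices `p₀ ≤ ρ₀·e^{−κ₁(R₀+2)}` (birth window `R₀ + 2`) and
`p ≤ e^{−κ₁(R₀+1)}·η₀` (renewal window `R₀ + 1`), every dictionary record price is at most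
`ρ₀ e^{−κ₁ W(j,0,0)} ∏_{e ∈ Q} (e^{−κ₁ W e} η e)`. [folklore] -/
theorem recPriceD_le {p₀ p ρ₀ η₀ κ₁ : ℝ} {R₀ n₁ : ℕ} (hp₀ : 0 ≤ p₀) (hp : 0 ≤ p) (hη₀ : 0 ≤ η₀)
    (hp₀ρ : p₀ ≤ ρ₀ * Real.exp (-(κ₁ * (R₀ + 2)))) (hpη : p ≤ Real.exp (-(κ₁ * (R₀ + 1))) * η₀)
    (Ah j : ℕ) (Q : Finset PEv) :
    recPriceD p₀ p (R₀ + 1) Ah j Q ≤ ρ₀ * Real.exp (-(κ₁ * (dictW (fun _ => R₀) n₁ ((j, 0, 0) : PEv) : ℕ))) *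
      ∏ e ∈ Q, (Real.exp (-(κ₁ * (dictW (fun _ => R₀) n₁ e : ℕ))) * etaD η₀ e) := by
  have hρ₀e : 0 ≤ ρ₀ * Real.exp (-(κ₁ * (R₀ + 2))) := hp₀.trans hp₀ρ
  have hbirth : ((dictW (fun _ => R₀) n₁ ((j, 0, 0) : PEv) : ℕ) : ℝ) = R₀ + 2 := by
    rw [dictW_birth, fatWait_zero]; push_cast; ring
  set B := ρ₀ * Real.exp (-(κ₁ * (dictW (fun _ => R₀) n₁ ((j, 0, 0) : PEv) : ℕ))) *
      ∏ e ∈ Q, (Real.exp (-(κ₁ * (dictW (fun _ => R₀) n₁ e : ℕ))) * etaD η₀ e) with hB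
  have hB0 : 0 ≤ B := by
    rw [hB, hbirth]
    exact mul_nonneg hρ₀e (Finset.prod_nonneg fun e _ => mul_nonneg (Real.exp_pos _).le (etaD_nonneg hη₀ e))
  set F := (pendChains (R₀ + 1) Ah).filter (fun S => shiftD j S = Q) with hF
  have hcard : F.card ≤ 1 := Finset.card_le_one.2 fun S hS S' hS' =>
    shiftD_injective j (by rw [(Finset.mem_filter.1 hS).2, (Finset.mem_filter.1 hS').2])
  have hcard' : (F.card : ℝ) ≤ 1 := by exact_mod_cast hcard
  have hle : ∀ S ∈ F, chainPrice p₀ p S ≤ B := fun S hS => by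
    have hQ : shiftD j S = Q := (Finset.mem_filter.1 hS).2
    have hprod : ∏ e ∈ Q, (Real.exp (-(κ₁ * (dictW (fun _ => R₀) n₁ e : ℕ))) * etaD η₀ e) =
        (Real.exp (-(κ₁ * (R₀ + 1))) * η₀) ^ S.card := by
      rw [← hQ, shiftD, Finset.prod_map, ← Finset.prod_const]
      refine Finset.prod_congr rfl fun a _ => ?_
      simp only [devt, Function.Embedding.coeFn_mk, dictW_renew, etaD, PEv.kind_mk, if_true]
      push_cast; ring_nf
    rw [hB, hbirth, hprod, chainPrice]
    exact mul_le_mul hp₀ρ (pow_le_pow_left₀ hp hpη _) (pow_nonneg hp _) hρ₀e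
  calc recPriceD p₀ p (R₀ + 1) Ah j Q = ∑ S ∈ F, chainPrice p₀ p S := rfl
    _ ≤ ∑ _S ∈ F, B := Finset.sum_le_sum hle
    _ = F.card * B := by rw [Finset.sum_const, nsmul_eq_mul]
    _ ≤ 1 * B := mul_le_mul_of_nonneg_right hcard' hB0
    _ = B := one_mul _

variable {N : ℕ}

/-- **`hdom` OF `slotDom_of_records_dict`, DISCHARGED ON THE RUN WITH WINDOW `R₀ + 1`** (one birth kind per slot,
`dictB_one`; the ratio clause an equality by `fibre_sum_eq` + `sum_recPriceD`). [folklore] -/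
theorem dom_run_dict (R₀ n₁ : ℕ) (a : ℕ → ℝ) {p₀ p ρ₀ η₀ κ₁ : ℝ} (hp₀ : 0 ≤ p₀) (hp : 0 ≤ p) (hη₀ : 0 ≤ η₀)
    (hp₀ρ : p₀ ≤ ρ₀ * Real.exp (-(κ₁ * (R₀ + 2)))) (hpη : p ≤ Real.exp (-(κ₁ * (R₀ + 1))) * η₀) (K : ℕ) :
    ∃ (n : ℕ) (Φ : SwitchOff (terms N (R₀ + 1) K) n) (birth : Fin n → ℕ) (cell : Fin n → Unit)
        (y : Fin n → PEv → Finset PEv → ℝ),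
      (runSwitchOff N (R₀ + 1) K).bad = Φ.bad ∧ (∀ i, birth i < jhalf K) ∧
      (∀ i, cell i ∈ (Finset.univ : Finset Unit)) ∧
      Function.Injective (fun i => (⟨birth i, cell i⟩ : Σ _ : ℕ, Unit)) ∧
      (∀ i, ∀ b ∈ dictB (fun _ => 1) K (birth i),
        ∀ Q ∈ records (dictW (fun _ => R₀) n₁) (birth i) K (dictE (fun _ => 1) K (birth i)) b, 0 ≤ y i b Q) ∧
      (∀ i, ∀ b ∈ dictB (fun _ => 1) K (birth i),
        ∀ Q ∈ records (dictW (fun _ => R₀) n₁) (birth i) K (dictE (fun _ => 1) K (birth i)) b,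
        y i b Q ≤ ρ₀ * Real.exp (-(κ₁ * (dictW (fun _ => R₀) n₁ b : ℕ))) *
          ∏ e ∈ Q, (Real.exp (-(κ₁ * (dictW (fun _ => R₀) n₁ e : ℕ))) * etaD η₀ e)) ∧
      ∀ i : Fin n, ∀ τ'' ∈ terms N (R₀ + 1) K, Φ.pend i τ'' = false →
        ∑ τ ∈ terms N (R₀ + 1) K with (Φ.pend i τ = true ∧ Φ.off i τ = τ''), runWeight a p₀ p K τ ≤
          (∑ b ∈ dictB (fun _ => 1) K (birth i),
            ∑ Q ∈ records (dictW (fun _ => R₀) n₁) (birth i) K (dictE (fun _ => 1) K (birth i)) b, y i b Q) *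
            runWeight a p₀ p K τ'' := by
  refine ⟨nsl N K, runSwitchOff N (R₀ + 1) K, fun i => (slot i : ℕ), fun _ => (),
    fun i _ Q => recPriceD p₀ p (R₀ + 1) (K - (slot i : ℕ)) (slot i : ℕ) Q, rfl, fun i => slot_lt_jhalf i,
    fun _ => Finset.mem_univ _, ?_, ?_, ?_, ?_⟩
  · intro i i' h
    have h' : ((slot i : ℕ)) = (slot i' : ℕ) := congrArg Sigma.fst h
    exact Fin.ext (by simpa [slot] using h')
  · intro i b _ Q _
    exact recPriceD_nonneg hp₀ hp _ _ _ Q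
  · intro i b hb Q _
    rw [dictB_one, Finset.mem_singleton] at hb
    subst hb
    exact recPriceD_le hp₀ hp hη₀ hp₀ρ hpη _ _ Q
  · intro i τ'' hτ'' hpend
    rw [dictB_one, Finset.sum_singleton, sum_recPriceD, fibre_sum_eq a p₀ p i hτ'' hpend]

/-- **THE DICTIONARY CARRIER INHABITED: `SlotDom` OF THE RUN BY `slotDom_of_records_dict`.**  Window table
`dictW (fun _ ↦ R₀) n₁` (any merger allowance `n₁` — the model has no mergers), unit fatness cap, chain window = the
renewal reach `R₀ + 1`, residuals `ρ ≡ ρ₀`, `η = etaD η₀`, one cell per age at `Λ ≥ 1`, model prices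
`p₀ ≤ ρ₀·e^{−κ₁(R₀+2)}`, `p ≤ e^{−κ₁(R₀+1)}·η₀`, rate `Λ·e^{η₀ − κ₁} < 1` ⇒ the same two-rate `SlotDom` budget.  Every
hypothesis of `slotDom_of_records_dict` discharged (`dom_run_dict`, `dictB_one`, `sum_etaD_le`). [folklore] -/
theorem slotDom_run_dict (N R₀ n₁ : ℕ) (l₀ : ℝ) (a : ℕ → ℝ) {p₀ p ρ₀ η₀ κ₁ Λ : ℝ} (hp₀ : 0 ≤ p₀) (hp : 0 ≤ p)
    (hκ : 0 ≤ κ₁) (hΛ : 1 ≤ Λ) (hp₀ρ : p₀ ≤ ρ₀ * Real.exp (-(κ₁ * (R₀ + 2))))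
    (hpη : p ≤ Real.exp (-(κ₁ * (R₀ + 1))) * η₀) (hr : Λ * Real.exp (η₀ - κ₁) < 1) :
    SlotDom l₀ (terms N (R₀ + 1)) (fun K _ τ => runWeight a p₀ p K τ) (fun K _ => (runSwitchOff N (R₀ + 1) K).bad)
      fun K => ρ₀ * Real.exp (-κ₁) * 1 *
        ((Λ * Real.exp (η₀ - κ₁)) ^ (K - jhalf K + 1) / (1 - Λ * Real.exp (η₀ - κ₁))) := by
  have hρ₀ : 0 ≤ ρ₀ := (mul_nonneg_iff_of_pos_right (Real.exp_pos _)).1 (hp₀.trans hp₀ρ)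
  have hη₀ : 0 ≤ η₀ := (mul_nonneg_iff_of_pos_left (Real.exp_pos _)).1 (hp.trans hpη)
  refine slotDom_of_records_dict (fun _ _ => (Finset.univ : Finset Unit)) zero_le_one (zero_le_one.trans hΛ) ?_
    (fun _ => R₀) n₁ (fun _ => 1) hκ (fun _ => ρ₀) (fun _ _ _ _ => hρ₀) ?_ (etaD η₀)
    (fun _ _ e _ => etaD_nonneg hη₀ e) (fun K j t _ => sum_etaD_le hη₀ K j t) hr jhalf
    (fun K => Nat.div_le_self K 2) fun K _ _ => dom_run_dict R₀ n₁ a hp₀ hp hη₀ hp₀ρ hpη K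
  · intro K a'
    rw [Finset.card_univ, Fintype.card_unit, Nat.cast_one, one_mul]
    exact one_le_pow₀ hΛ
  · intro K j
    rw [dictB_one, Finset.sum_singleton]

end Dictionary

/-! ## §6 Sanity, decided and numeric -/

namespace Sanity

/-- window `2`, birth `0`, cutoff `3`: P1's records are the seven non-empty subsets of `{1, 2, 3}` … -/
example : records (fun _ : ℕ => 2) 0 3 (Ioc 0 3) 0 = {{1}, {2}, {3}, {1, 2}, {1, 3}, {2, 3}, {1, 2, 3}} := by
  decide

/-- … P2's pending chains are five of them (`T4RenewalChains` §5) … -/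
example : pendChains 2 3 = {{2}, {1, 2}, {1, 3}, {2, 3}, {1, 2, 3}} := by decide

/-- … so the records OVER-COUNT by exactly two: `{1}` is a chain renormalised AT the horizon (`3 < 1 + 2` fails) and
`{3}` is no chain (the renewal at age `3 > 0 + 2` comes after the component was renormalised). -/
example : {1} ∈ records (fun _ : ℕ => 2) 0 3 (Ioc 0 3) 0 ∧ ({1} : Finset ℕ) ∉ pendChains 2 3 ∧
    {3} ∈ records (fun _ : ℕ => 2) 0 3 (Ioc 0 3) 0 ∧ ¬ Linked 2 ({3} : Finset ℕ) := by
  decide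

/-- the shift at birth `j = 1`: the pending chain of ages `{1, 3}` is the record of steps `{2, 4}` at cutoff `4` -/
example : shift 1 {1, 3} = {2, 4} ∧ shift 1 {1, 3} ∈ records (fun _ : ℕ => 2) 1 4 (Ioc 1 4) 1 := by decide

/-- the rate of the numeric instance: `2·e^{1 − 2} < 1`, i.e. `2 < e` [folklore] -/
theorem two_mul_exp_neg_one_lt_one : (2 : ℝ) * Real.exp (1 - 2) < 1 := by
  have h : (1 : ℝ) + 1 < Real.exp 1 := Real.add_one_lt_exp (by norm_num)
  have h1 : Real.exp (1 - 2) = (Real.exp 1)⁻¹ := by rw [show (1 : ℝ) - 2 = -1 by norm_num, Real.exp_neg]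
  rw [h1, mul_inv_lt_iff₀ (Real.exp_pos 1)]
  linarith

/-- **EVERY HYPOTHESIS OF `relWeightBound_run_records` AT ONCE**: window `R = 1`, entropy `Λ = 2`, P1 currency
`κ₁ = 2`, `ρ₀ = η₀ = 1`, all four model prices at their extreme values `e^{−2}`, any number of slots `N`
(non-vacuous for `N ≥ 1`, `K ≥ 2` by §4). -/
example (N : ℕ) (l₀ : ℝ) :
    RelWeightBound l₀ (terms N 1) (fun K _ τ => runWeight (fun _ => 1) (Real.exp (-2)) (Real.exp (-2)) K τ)
      (fun K _ τ => runWeight (fun _ => 1) (Real.exp (-2)) (Real.exp (-2)) K τ)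
      (fun K _ => (runSwitchOff N 1 K).bad) fun K =>
        1 - Real.exp (-((1 : ℝ) * Real.exp (-2) * 1 *
          ((2 * Real.exp (1 - 2)) ^ (K - jhalf K + 1) / (1 - 2 * Real.exp (1 - 2))))) :=
  relWeightBound_run_records N 1 l₀ (fun _ => 1) (fun _ => 1) (fun _ => zero_le_one) (fun _ => zero_le_one)
    (Real.exp_pos _).le (Real.exp_pos _).le (Real.exp_pos _).le (Real.exp_pos _).le (by norm_num) (by norm_num)
    (by norm_num) (by norm_num) (by norm_num) (by norm_num) two_mul_exp_neg_one_lt_one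

/-- … and at that instance the bad class at cutoff `K = 4` with one coordinate carries positive weight -/
example : 0 < ∑ τ ∈ (runSwitchOff 1 1 4).bad, runWeight (fun _ => (1 : ℝ)) (Real.exp (-2)) (Real.exp (-2)) 4 τ :=
  bad_weight_pos le_rfl (by norm_num) le_rfl one_pos (Real.exp_pos _) (Real.exp_pos _)

end Sanity

end Literature.MathematicalPhysics.QuantumFieldTheory.Balaban1983to89.T4RecordChains
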